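import Literature.NumberTheory.DiophantineGeometry.GenEllDeGoodPrimes
import Literature.IUT.LogVolume.HeightDivisor
import Mathlib.Tactic.LinearCombination
import HarnessLib

/-!
# [GenEll] Thm. 2.1 on the `D_e` route: the good-place multiplicity inequalities, descent-friendly
# form and `ord` form

S. Mochizuki, *Arithmetic elliptic curves in general position*, Math. J. Okayama Univ. 52 (2010),
Prop. 1.6 p. 10 for a REDUCED divisor, proof of Thm. 2.1 pp. 12–13 [cite: MochizukiGenEll2010, Prop 1.6 p.10].
Support file for the route item `GenEllTwo` (stmt-ABC-19679), package W4b/W5 of abc-iut-S6's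
GENELLTWO-P1ROUTE note, holder abc-iut-w5-d045; classical, nothing here bears on [IUTchIII] Cor. 3.12.

Two services for the W9 assembly, on top of `GenEllDeGoodPrimes.lean`:

* **descent-friendly form.** `De.valuation_sub_lt_valuation_N_of_gap` / `De.good_place_dichotomy_of_gap`
  take, instead of «`G_b` splits with separated roots and tame multiplicities», only the CONCLUSION of the
  multiplicity-gap lemma for `G_b` at the place,
  `hgap : ∀ ρ, v ρ ≤ 1 → G_b(ρ) ≠ 0 → v (G_b ρ) < 1 → v (G_b ρ) < v (G_b' ρ)`,
  which holds at every place `w ∤ D(G_b)` of EVERY number field (no splitting field needed; this is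
  the shape of the uniform good-reduction modulus `GoodPrime.exists_modulus_val_aeval_lt_val_aeval_derivative`,
  abc-iut-w5-d027), so the sharp inequality can be applied over the field of definition `ℚ(P)` itself;
* **`ord` form.** `De.ord_placewise_of_gap` / `De.ord_placewise`: at a finite place `w` of a number
  field `L` (with `ord = Literature.IUT.LogVolume.ord`) the dichotomy becomes literally the placewise
  hypotheses of the summation over all places (`FibreConductor.sum_logNorm_le_of_placewise`,
  abc-iut-w5-d009) with ZERO defect at `w`: writing `τ_b := t − b`,
  `(∃ b ∈ B, 0 < ord_w τ_b) → 1 + ord⁺_w N ≤ Σ_{b∈B} ord⁺_w τ_b` and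
  `(¬ ∃ b ∈ B, 0 < ord_w τ_b) → ord⁺_w N ≤ Σ_{b∈B} ord⁺_w τ_b` (`ord⁺ := Int.toNat ∘ ord`), and the
  packaged junction `De.hmeet_hoff_of_gap` (off a finite bad set `Sbad`, with the finite meeting set
  `W`, `De.finite_setOf_meets`) = VERBATIM `hmeet`/`hoff` of `FibreConductor.sum_logNorm_le_slope`.
-/

noncomputable section

namespace Literature.NumberTheory.DiophantineGeometry.GenEll

open _root_.Polynomial NumberField IsDedekindDomain
open Literature.IUT.LogVolume

/-! ## The sharp inequality from the gap conclusion (descent-friendly form) -/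

section GapForm

variable {K : Type*} [Field K] {Γ₀ : Type*} [LinearOrderedCommGroupWithZero Γ₀]
  (v : Valuation K Γ₀) (k : ℕ)

/-- **The sharp inequality at a good place, descent-friendly form.** As
`De.valuation_sub_lt_valuation_N`, but the good reduction of the fibre polynomial `G_b` enters only
through the conclusion `hgap` of the multiplicity-gap lemma at the place (`v`-integral `ρ` with
`0 < v (G_b ρ) < 1` ⇒ `v (G_b ρ) < v (G_b' ρ)`), which is available at all but finitely many places of
every number field containing `b` (no splitting assumption): `v (t − b) < 1 ⇒ v (t − b) < v N`.
[cite: MochizukiGenEll2010, Prop 1.6 p.10] -/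
theorem De.valuation_sub_lt_valuation_N_of_gap (hv2 : v 2 = 1) {r s t N b : K}
    (hcurve : s ^ 2 = 1 - 4 * r ^ (2 * k + 1)) (ht : t * (r * s) = s + r ^ (k + 2))
    (hN : N = -s ^ 3 + (k + 1) * r ^ (k + 2) - 2 * r ^ (3 * k + 3)) (hN0 : N ≠ 0)
    (hb : v b ≤ 1) {g : K[X]}
    (hg : g = X ^ (2 * k + 4) + C (4 * b ^ 2) * X ^ (2 * k + 3) - C (8 * b) * X ^ (2 * k + 2)
      + C 4 * X ^ (2 * k + 1) - C (b ^ 2) * X ^ 2 + C (2 * b) * X - 1)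
    (hgap : ∀ ρ : K, v ρ ≤ 1 → g.eval ρ ≠ 0 → v (g.eval ρ) < 1 →
      v (g.eval ρ) < v ((derivative g).eval ρ))
    (htb : v (t - b) < 1) : v (t - b) < v N := by
  by_cases htb0 : t - b = 0
  · rw [htb0, map_zero]
    exact zero_lt_iff.2 ((v.ne_zero_iff).2 hN0)
  have htv : v t ≤ 1 := by
    have : t = (t - b) + b := by ring
    rw [this]
    exact v.map_add_le htb.le hb
  have hr := De.valuation_r_eq_one v k hcurve ht htv
  obtain ⟨hs, hrt⟩ := De.valuation_s_eq_one v k hcurve ht htv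
  have hG := De.planeModel_eq_zero k hcurve ht
  have hgr : g.eval r = (b - t) * r * (1 - 4 * r ^ (2 * k + 1)) * (2 - (b + t) * r) := by
    rw [De.eval_fiber k b hg]
    linear_combination De.fiber_sub_fiber k r b t + hG
  have hunit : v (2 - (b + t) * r) = 1 := by
    have e : 2 - (b + t) * r = -(2 * (r * t - 1)) + (t - b) * r := by ring
    rw [e, v.map_add_eq_of_lt_left]
    · simp only [v.map_neg, map_mul, hv2, hrt, one_mul]
    · simp only [v.map_neg, map_mul, hv2, hrt, hr, mul_one]
      exact htb
  have hvg : v (g.eval r) = v (t - b) := by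
    rw [hgr, map_mul, map_mul, map_mul, hunit, mul_one, ← hcurve, map_pow, hs, one_pow, mul_one,
      hr, mul_one, v.map_sub_swap]
  have hg0 : g.eval r ≠ 0 := by
    intro h0
    rw [h0, map_zero] at hvg
    exact htb0 ((v.zero_iff).1 hvg.symm)
  -- the multiplicity gap at `ρ = r`
  have hgap' := hgap r hr.le hg0 (by rw [hvg]; exact htb)
  rw [hvg, De.eval_derivative_fiber k b hg] at hgap'
  -- `G'_t(r) ≡ G'_b(r)` modulo `t − b`
  have hdiff : (2 * k + 4) * r ^ (2 * k + 3) + 4 * (2 * k + 3) * t ^ 2 * r ^ (2 * k + 2)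
        - 8 * (2 * k + 2) * t * r ^ (2 * k + 1) + 4 * (2 * k + 1) * r ^ (2 * k) - 2 * t ^ 2 * r + 2 * t
      = ((2 * k + 4) * r ^ (2 * k + 3) + 4 * (2 * k + 3) * b ^ 2 * r ^ (2 * k + 2)
        - 8 * (2 * k + 2) * b * r ^ (2 * k + 1) + 4 * (2 * k + 1) * r ^ (2 * k) - 2 * b ^ 2 * r + 2 * b)
        + (t - b) * (4 * (2 * k + 3) * (t + b) * r ^ (2 * k + 2) - 8 * (2 * k + 2) * r ^ (2 * k + 1)
          - 2 * (t + b) * r + 2) := by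
    ring
  have hM : v (4 * (2 * k + 3) * (t + b) * r ^ (2 * k + 2) - 8 * (2 * k + 2) * r ^ (2 * k + 1)
      - 2 * (t + b) * r + 2) ≤ 1 := by
    have hn : ∀ n : ℕ, v (n : K) ≤ 1 := fun n => (v.mem_integer_iff _).1 (natCast_mem v.integer n)
    have h4 : v (4 : K) ≤ 1 := by exact_mod_cast hn 4
    have h8 : v (8 : K) ≤ 1 := by exact_mod_cast hn 8
    have h2 : v (2 : K) ≤ 1 := by exact_mod_cast hn 2
    have h23 : v (2 * k + 3 : K) ≤ 1 := by exact_mod_cast hn (2 * k + 3)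
    have h22 : v (2 * k + 2 : K) ≤ 1 := by exact_mod_cast hn (2 * k + 2)
    have htb' : v (t + b) ≤ 1 := v.map_add_le htv hb
    refine v.map_add_le (v.map_sub_le (v.map_sub_le ?_ ?_) ?_) h2
    · rw [map_mul, map_mul, map_mul, map_pow]
      exact mul_le_one' (mul_le_one' (mul_le_one' h4 h23) htb') (pow_le_one' hr.le _)
    · rw [map_mul, map_mul, map_pow]
      exact mul_le_one' (mul_le_one' h8 h22) (pow_le_one' hr.le _)
    · rw [map_mul, map_mul]
      exact mul_le_one' (mul_le_one' h2 htb') hr.le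
  have hGr : v ((2 * k + 4) * r ^ (2 * k + 3) + 4 * (2 * k + 3) * t ^ 2 * r ^ (2 * k + 2)
        - 8 * (2 * k + 2) * t * r ^ (2 * k + 1) + 4 * (2 * k + 1) * r ^ (2 * k) - 2 * t ^ 2 * r + 2 * t)
      = v ((2 * k + 4) * r ^ (2 * k + 3) + 4 * (2 * k + 3) * b ^ 2 * r ^ (2 * k + 2)
        - 8 * (2 * k + 2) * b * r ^ (2 * k + 1) + 4 * (2 * k + 1) * r ^ (2 * k) - 2 * b ^ 2 * r
        + 2 * b) := by
    rw [hdiff, v.map_add_eq_of_lt_left]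
    rw [map_mul]
    exact lt_of_le_of_lt (mul_le_of_le_one_right' hM) hgap'
  have hkey := De.sq_mul_Gr_eq k hcurve ht hN
  have hvN : v ((2 * k + 4) * r ^ (2 * k + 3) + 4 * (2 * k + 3) * t ^ 2 * r ^ (2 * k + 2)
        - 8 * (2 * k + 2) * t * r ^ (2 * k + 1) + 4 * (2 * k + 1) * r ^ (2 * k) - 2 * t ^ 2 * r + 2 * t)
      = v N := by
    have h1 := congrArg v hkey
    rw [map_mul, map_mul, map_pow, map_pow, hr, hs, one_pow, one_pow, one_mul, one_mul] at h1
    rw [h1, map_mul, map_mul, map_mul, hv2, map_pow, hr, one_pow, hs, mul_one, mul_one, one_mul]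
  rw [← hvN, hGr]
  exact hgap'

/-- The good reduction hypotheses of `De.valuation_sub_lt_valuation_N` (fibre polynomial split, roots
pairwise distinct modulo `v`, multiplicities `v`-units) give the gap conclusion `hgap` (by the
multiplicity-gap lemma; the roots are integral because `G_b` is monic with integral coefficients).
[cite: MochizukiGenEll2010, Prop 1.6 p.10] -/
theorem De.gap_of_splits {b : K} (hb : v b ≤ 1) {g : K[X]}
    (hg : g = X ^ (2 * k + 4) + C (4 * b ^ 2) * X ^ (2 * k + 3) - C (8 * b) * X ^ (2 * k + 2)
      + C 4 * X ^ (2 * k + 1) - C (b ^ 2) * X ^ 2 + C (2 * b) * X - 1)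
    (hsplit : g.Splits) (hsep : ∀ a ∈ g.roots, ∀ a' ∈ g.roots, a ≠ a' → v (a - a') = 1)
    (htame : ∀ a ∈ g.roots, v (g.rootMultiplicity a : K) = 1) :
    ∀ ρ : K, v ρ ≤ 1 → g.eval ρ ≠ 0 → v (g.eval ρ) < 1 →
      v (g.eval ρ) < v ((derivative g).eval ρ) := by
  intro ρ hρ hg0 hlt
  have hlc : v g.leadingCoeff = 1 := by rw [(De.fiber_monic k b hg).leadingCoeff, map_one]
  have hint : ∀ a ∈ g.roots, v a ≤ 1 := fun a ha =>
    valuation_le_one_of_isRoot v (De.valuation_coeff_fiber_le_one k v hb hg) hlc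
      ((mem_roots (De.fiber_monic k b hg).ne_zero).1 ha)
  exact (valuation_eval_lt_valuation_eval_derivative v hsplit hlc hint hsep htame hρ hg0 hlt).2

/-- **Dichotomy at a good place, descent-friendly form** (as `De.good_place_dichotomy`, with the good
reduction of each fibre polynomial entering through its gap conclusion `hgap`).
[cite: MochizukiGenEll2010, Prop 1.6 p.10] -/
theorem De.good_place_dichotomy_of_gap (hv2 : v 2 = 1) {r s t N : K}
    (hcurve : s ^ 2 = 1 - 4 * r ^ (2 * k + 1)) (ht : t * (r * s) = s + r ^ (k + 2))
    (hN : N = -s ^ 3 + (k + 1) * r ^ (k + 2) - 2 * r ^ (3 * k + 3)) (hN0 : N ≠ 0)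
    (B : Finset K) (hB : ∀ b ∈ B, v b ≤ 1) (hBsep : ∀ b ∈ B, ∀ b' ∈ B, b ≠ b' → v (b - b') = 1)
    (g : K → K[X])
    (hg : ∀ b ∈ B, g b = X ^ (2 * k + 4) + C (4 * b ^ 2) * X ^ (2 * k + 3) - C (8 * b) * X ^ (2 * k + 2)
      + C 4 * X ^ (2 * k + 1) - C (b ^ 2) * X ^ 2 + C (2 * b) * X - 1)
    (hgap : ∀ b ∈ B, ∀ ρ : K, v ρ ≤ 1 → (g b).eval ρ ≠ 0 → v ((g b).eval ρ) < 1 →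
      v ((g b).eval ρ) < v ((derivative (g b)).eval ρ))
    (hconv : v N < 1 → ∃ b ∈ B, v (t - b) < 1) :
    (∃ b ∈ B, v (t - b) < 1 ∧ v (t - b) < v N ∧ ∀ b' ∈ B, b' ≠ b → v (t - b') = 1) ∨
      ((∀ b ∈ B, 1 ≤ v (t - b)) ∧ 1 ≤ v N) := by
  by_cases h : ∃ b ∈ B, v (t - b) < 1
  · obtain ⟨b, hbB, htb⟩ := h
    refine Or.inl ⟨b, hbB, htb, ?_, fun b' hb' hne => ?_⟩
    · exact De.valuation_sub_lt_valuation_N_of_gap v k hv2 hcurve ht hN hN0 (hB b hbB) (hg b hbB)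
        (hgap b hbB) htb
    · exact De.valuation_sub_eq_one_of_ne v htb (hBsep b hbB b' hb' (Ne.symm hne))
  · push Not at h
    refine Or.inr ⟨h, ?_⟩
    by_contra hN1
    push Not at hN1
    obtain ⟨b, hbB, htb⟩ := hconv hN1
    exact (lt_irrefl _) ((h b hbB).trans_lt htb)

end GapForm

/-! ## `ord` versus the valuation at a finite place of a number field -/

section Ord

variable {L : Type*} [Field L] [NumberField L]

/-- `ord_w x = 0` when `x` is a `w`-unit. [cite: MochizukiGenEll2010, Prop 1.6 p.10] -/
theorem ord_eq_zero_of_valuation_eq_one (w : HeightOneSpectrum (𝓞 L)) {x : L}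
    (hx : w.valuation L x = 1) : ord L w x = 0 := by
  rw [ord, hx, WithZero.log_one, neg_zero]

/-- `ord_w x ≤ 0` when `1 ≤ w(x)`. [cite: MochizukiGenEll2010, Prop 1.6 p.10] -/
theorem ord_nonpos_of_one_le_valuation (w : HeightOneSpectrum (𝓞 L)) {x : L}
    (hx : 1 ≤ w.valuation L x) : ord L w x ≤ 0 := by
  have hx0 : w.valuation L x ≠ 0 := ne_of_gt (lt_of_lt_of_le zero_lt_one hx)
  rw [ord, neg_nonpos, ← WithZero.log_one]
  exact (WithZero.log_le_log one_ne_zero hx0).2 hx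

/-- For nonzero `x`, `y`: `ord_w y < ord_w x ↔ w(x) < w(y)`. [cite: MochizukiGenEll2010, Prop 1.6 p.10] -/
theorem ord_lt_ord_iff (w : HeightOneSpectrum (𝓞 L)) {x y : L} (hx : x ≠ 0) (hy : y ≠ 0) :
    ord L w y < ord L w x ↔ w.valuation L x < w.valuation L y := by
  have hvx : w.valuation L x ≠ 0 := (w.valuation L).ne_zero_iff.mpr hx
  have hvy : w.valuation L y ≠ 0 := (w.valuation L).ne_zero_iff.mpr hy
  rw [ord, ord, neg_lt_neg_iff, WithZero.log_lt_log hvx hvy]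

/-! ## The placewise inequalities at a good place -/

/-- **Good-place multiplicity inequalities in `ord` form, descent-friendly hypotheses** ([GenEll]
Prop. 1.6, sharp form, for the reduced divisor `t⁻¹(B)` on `D_e`). At a finite place `w` of a number
field `L` with `w(2) = 1`, for a point `(r, s, t)` of `D_e` (`s² = 1 − 4r^{2k+1}`, `t·(rs) = s + r^{k+2}`)
with `N = −s³ + (k+1)r^{k+2} − 2r^{3k+3} ≠ 0` and `t ∉ B`, where the finitely many values `b ∈ B` are
`w`-integral and pairwise distinct modulo `w`, each fibre polynomial `G_b` satisfies the gap conclusion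
`hgap` at `w`, and given the converse direction `hconv` (package W5c): if `t` meets `B` at `w` then
`1 + ord⁺_w N ≤ Σ_b ord⁺_w (t − b)`, and otherwise `ord⁺_w N ≤ Σ_b ord⁺_w (t − b)` — the hypotheses
`hmeet`/`hoff` of `FibreConductor.sum_logNorm_le_of_placewise` with zero defect at `w` (`τ b := t − b`,
`a := N`). [cite: MochizukiGenEll2010, Prop 1.6 p.10] -/
theorem De.ord_placewise_of_gap (w : HeightOneSpectrum (𝓞 L)) (k : ℕ) (hv2 : w.valuation L 2 = 1)
    {r s t N : L} (hcurve : s ^ 2 = 1 - 4 * r ^ (2 * k + 1)) (ht : t * (r * s) = s + r ^ (k + 2))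
    (hN : N = -s ^ 3 + (k + 1) * r ^ (k + 2) - 2 * r ^ (3 * k + 3)) (hN0 : N ≠ 0)
    (B : Finset L) (htB : ∀ b ∈ B, t ≠ b) (hB : ∀ b ∈ B, w.valuation L b ≤ 1)
    (hBsep : ∀ b ∈ B, ∀ b' ∈ B, b ≠ b' → w.valuation L (b - b') = 1)
    (g : L → L[X])
    (hg : ∀ b ∈ B, g b = X ^ (2 * k + 4) + C (4 * b ^ 2) * X ^ (2 * k + 3) - C (8 * b) * X ^ (2 * k + 2)
      + C 4 * X ^ (2 * k + 1) - C (b ^ 2) * X ^ 2 + C (2 * b) * X - 1)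
    (hgap : ∀ b ∈ B, ∀ ρ : L, w.valuation L ρ ≤ 1 → (g b).eval ρ ≠ 0 →
      w.valuation L ((g b).eval ρ) < 1 →
      w.valuation L ((g b).eval ρ) < w.valuation L ((derivative (g b)).eval ρ))
    (hconv : w.valuation L N < 1 → ∃ b ∈ B, w.valuation L (t - b) < 1) :
    ((∃ b ∈ B, 0 < ord L w (t - b)) →
        1 + (ord L w N).toNat ≤ ∑ b ∈ B, (ord L w (t - b)).toNat) ∧
      ((¬ ∃ b ∈ B, 0 < ord L w (t - b)) → (ord L w N).toNat ≤ ∑ b ∈ B, (ord L w (t - b)).toNat) := by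
  classical
  have htb0 : ∀ b ∈ B, t - b ≠ 0 := fun b hb => sub_ne_zero.mpr (htB b hb)
  rcases De.good_place_dichotomy_of_gap (w.valuation L) k hv2 hcurve ht hN hN0 B hB hBsep g hg hgap
      hconv with ⟨b₀, hb₀, hlt1, hltN, hothers⟩ | ⟨hall, hN1⟩
  · -- `t` meets `b₀`: the sum is `ord_w (t − b₀) ≥ ord_w N + 1`, and `≥ 1`
    have hpos : 0 < ord L w (t - b₀) := (ord_pos_iff_valuation_lt_one L w (htb0 b₀ hb₀)).2 hlt1
    have hzero : ∀ b ∈ B, b ≠ b₀ → (ord L w (t - b)).toNat = 0 := fun b hb hne => by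
      rw [ord_eq_zero_of_valuation_eq_one w (hothers b hb hne), Int.toNat_zero]
    have hsum : ∑ b ∈ B, (ord L w (t - b)).toNat = (ord L w (t - b₀)).toNat := by
      rw [← Finset.sum_erase_add _ _ hb₀, Finset.sum_eq_zero fun b hb => ?_, zero_add]
      exact hzero b (Finset.mem_of_mem_erase hb) (Finset.ne_of_mem_erase hb)
    have hmain : 1 + (ord L w N).toNat ≤ (ord L w (t - b₀)).toNat := by
      have hlt : ord L w N < ord L w (t - b₀) := (ord_lt_ord_iff w (htb0 b₀ hb₀) hN0).2 hltN
      have h1 : ((ord L w (t - b₀)).toNat : ℤ) = ord L w (t - b₀) := Int.toNat_of_nonneg hpos.le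
      zify
      rw [h1]
      rcases le_or_gt 0 (ord L w N) with h | h
      · rw [Int.toNat_of_nonneg h]; omega
      · rw [Int.toNat_eq_zero.mpr h.le]; push_cast; omega
    exact ⟨fun _ => hsum ▸ hmain, fun hno => absurd ⟨b₀, hb₀, hpos⟩ hno⟩
  · -- `t` meets no value of `B`: `N` is not small
    have hN0' : (ord L w N).toNat = 0 :=
      Int.toNat_eq_zero.mpr (ord_nonpos_of_one_le_valuation w hN1)
    refine ⟨fun ⟨b, hb, hpos⟩ => ?_, fun _ => by rw [hN0']; exact Nat.zero_le _⟩
    have := (ord_pos_iff_valuation_lt_one L w (htb0 b hb)).1 hpos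
    exact absurd (hall b hb) (not_le.mpr this)

/-- **Good-place multiplicity inequalities in `ord` form** (split hypotheses: every fibre polynomial
`G_b` splits in `L` with roots pairwise distinct modulo `w` and `w`-unit multiplicities). Same
conclusion as `De.ord_placewise_of_gap`. [cite: MochizukiGenEll2010, Prop 1.6 p.10] -/
theorem De.ord_placewise (w : HeightOneSpectrum (𝓞 L)) (k : ℕ) (hv2 : w.valuation L 2 = 1)
    {r s t N : L} (hcurve : s ^ 2 = 1 - 4 * r ^ (2 * k + 1)) (ht : t * (r * s) = s + r ^ (k + 2))
    (hN : N = -s ^ 3 + (k + 1) * r ^ (k + 2) - 2 * r ^ (3 * k + 3)) (hN0 : N ≠ 0)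
    (B : Finset L) (htB : ∀ b ∈ B, t ≠ b) (hB : ∀ b ∈ B, w.valuation L b ≤ 1)
    (hBsep : ∀ b ∈ B, ∀ b' ∈ B, b ≠ b' → w.valuation L (b - b') = 1)
    (g : L → L[X])
    (hg : ∀ b ∈ B, g b = X ^ (2 * k + 4) + C (4 * b ^ 2) * X ^ (2 * k + 3) - C (8 * b) * X ^ (2 * k + 2)
      + C 4 * X ^ (2 * k + 1) - C (b ^ 2) * X ^ 2 + C (2 * b) * X - 1)
    (hsplit : ∀ b ∈ B, (g b).Splits)
    (hsep : ∀ b ∈ B, ∀ a ∈ (g b).roots, ∀ a' ∈ (g b).roots, a ≠ a' → w.valuation L (a - a') = 1)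
    (htame : ∀ b ∈ B, ∀ a ∈ (g b).roots, w.valuation L ((g b).rootMultiplicity a : L) = 1)
    (hconv : w.valuation L N < 1 → ∃ b ∈ B, w.valuation L (t - b) < 1) :
    ((∃ b ∈ B, 0 < ord L w (t - b)) →
        1 + (ord L w N).toNat ≤ ∑ b ∈ B, (ord L w (t - b)).toNat) ∧
      ((¬ ∃ b ∈ B, 0 < ord L w (t - b)) → (ord L w N).toNat ≤ ∑ b ∈ B, (ord L w (t - b)).toNat) :=
  De.ord_placewise_of_gap w k hv2 hcurve ht hN hN0 B htB hB hBsep g hg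
    (fun b hb => De.gap_of_splits (w.valuation L) k (hB b hb) (hg b hb) (hsplit b hb) (hsep b hb)
      (htame b hb)) hconv

/-! ## The junction with the summation over all places -/

/-- The set of finite places where `t` meets `B` (`0 < ord_w (t − b)` for some `b ∈ B`) is finite.
[cite: MochizukiGenEll2010, Prop 1.6 p.10] -/
theorem De.finite_setOf_meets (t : L) (B : Finset L) :
    {w : HeightOneSpectrum (𝓞 L) | ∃ b ∈ B, 0 < ord L w (t - b)}.Finite := by
  have h : ∀ b ∈ B, {w : HeightOneSpectrum (𝓞 L) | 0 < ord L w (t - b)}.Finite := fun b _ => by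
    refine (finite_setOf_ord_neg L (t - b)⁻¹).subset fun w hw => ?_
    simp only [Set.mem_setOf_eq, ord_inv, neg_lt_zero] at hw ⊢
    exact hw
  refine (Set.Finite.biUnion B.finite_toSet h).subset fun w hw => ?_
  obtain ⟨b, hb, hpos⟩ := hw
  exact Set.mem_biUnion (Finset.mem_coe.mpr hb) hpos

/-- **The W5 → W5d junction** ([GenEll] Prop. 1.6, sharp form, on `D_e`): for a point `(r, s, t)` of
`D_e` over a number field `L` with `N ≠ 0` and `t ∉ B`, a finite set `Sbad` of places OFF which `2` and
the values `b ∈ B` have good reduction, every fibre polynomial `G_b` satisfies the gap conclusion and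
the converse direction `hconv` holds, and the (finite) set `W` of places off `Sbad` where `t` meets `B`,
one has VERBATIM the hypotheses `hmeet`/`hoff` of `FibreConductor.sum_logNorm_le_slope` /
`inv_finrank_mul_sum_logNorm_le_slope` (abc-iut-w5-d009): on `W ∖ Sbad`,
`1 + ord⁺_w N ≤ Σ_{b∈B} ord⁺_w (t − b)`; off `W ∪ Sbad`, `ord⁺_w N ≤ Σ_{b∈B} ord⁺_w (t − b)`.
[cite: MochizukiGenEll2010, Prop 1.6 p.10] -/
theorem De.hmeet_hoff_of_gap (k : ℕ) {r s t N : L}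
    (hcurve : s ^ 2 = 1 - 4 * r ^ (2 * k + 1)) (ht : t * (r * s) = s + r ^ (k + 2))
    (hN : N = -s ^ 3 + (k + 1) * r ^ (k + 2) - 2 * r ^ (3 * k + 3)) (hN0 : N ≠ 0)
    (B : Finset L) (htB : ∀ b ∈ B, t ≠ b) (g : L → L[X])
    (hg : ∀ b ∈ B, g b = X ^ (2 * k + 4) + C (4 * b ^ 2) * X ^ (2 * k + 3) - C (8 * b) * X ^ (2 * k + 2)
      + C 4 * X ^ (2 * k + 1) - C (b ^ 2) * X ^ 2 + C (2 * b) * X - 1)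
    (Sbad W : Finset (HeightOneSpectrum (𝓞 L)))
    (h2 : ∀ w, w ∉ Sbad → w.valuation L 2 = 1)
    (hB : ∀ w, w ∉ Sbad → ∀ b ∈ B, w.valuation L b ≤ 1)
    (hBsep : ∀ w, w ∉ Sbad → ∀ b ∈ B, ∀ b' ∈ B, b ≠ b' → w.valuation L (b - b') = 1)
    (hgap : ∀ w, w ∉ Sbad → ∀ b ∈ B, ∀ ρ : L, w.valuation L ρ ≤ 1 → (g b).eval ρ ≠ 0 →
      w.valuation L ((g b).eval ρ) < 1 →
      w.valuation L ((g b).eval ρ) < w.valuation L ((derivative (g b)).eval ρ))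
    (hconv : ∀ w, w ∉ Sbad → w.valuation L N < 1 → ∃ b ∈ B, w.valuation L (t - b) < 1)
    (hW : ∀ w, w ∉ Sbad → (w ∈ W ↔ ∃ b ∈ B, 0 < ord L w (t - b))) :
    (∀ w ∈ W, w ∉ Sbad → 1 + (ord L w N).toNat ≤ ∑ b ∈ B, (ord L w (t - b)).toNat) ∧
      (∀ w, w ∉ W → w ∉ Sbad → (ord L w N).toNat ≤ ∑ b ∈ B, (ord L w (t - b)).toNat) := by
  refine ⟨fun w hwW hwS => ?_, fun w hwW hwS => ?_⟩
  · exact (De.ord_placewise_of_gap w k (h2 w hwS) hcurve ht hN hN0 B htB (hB w hwS) (hBsep w hwS)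
      g hg (hgap w hwS) (hconv w hwS)).1 ((hW w hwS).1 hwW)
  · exact (De.ord_placewise_of_gap w k (h2 w hwS) hcurve ht hN hN0 B htB (hB w hwS) (hBsep w hwS)
      g hg (hgap w hwS) (hconv w hwS)).2 (fun h => hwW ((hW w hwS).2 h))

end Ord

end Literature.NumberTheory.DiophantineGeometry.GenEll
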